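import Summits.PneNP.PneNP.Theorems.SfmBlMachineDegree

/-!
# Line «sfm-bl», MACHINE LAYER M5 dictionary (D1): the machine's pieces as a piece structure of the pipeline (stmt-PneNP-20523)

FRONTIER F-N1c; nothing here bears on P vs NP.

`SfmBl.cutCertified_of_pipeline` (prover-2, `SfmBlPipeline`) is parametric in a PIECE STRUCTURE
`src dst own₁ own₂` over finite types `α, β` with four compatibilities, leg-degrees `≤ 2^60` and the piece
count bound `N ≤ 2n+1+6m/2^60`.  This file instantiates it with the machine's block splitting (M1
`SfmBlMachine.pieceLegs`): `α = LPiece L I`, `β = RPiece L I` = the left / right piece LABELS occurring among the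
pieced legs of the instance, `srcM/dstM (j,t)` = the labels of leg `3j+t`, `own₁M (0,c,blk) = c`,
`own₂M (1,v,blk) = none / some (v−1)`; and proves the four compatibilities (`own₁M_srcM`, `own₂M_dstM_zero/one/two`),
the degree bounds (`card_filter_srcM_le`, `card_filter_dstM_le`, from `length_nbrs_pieceLegs_le`) and the
leg-index bookkeeping (`legIdx`, `plegOf`).  The piece-count bound and the connectivity transfer are D1b.
-/

set_option linter.dupNamespace false -- `Summit.PneNP.PneNP.…`: summit = sub-problem name (D-0017 single-conjunct layout)

namespace Summit.PneNP.PneNP.Theorems.SfmBlMachine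

open Literature.Computability.Complexity
open Summit.PneNP.PneNP.Theorems.Nc03AvoidResidualCoreCandFewHeadsRungFP (trips tripOf)

variable {n m : ℕ}

/-! ## Legs `Fin m × Fin 3` ↔ indices `3j + t` -/

/-- The instance has `m` triples. -/
theorem length_trips (I : LocalMap 3 n m) : (trips I).length = m := by
  simp [trips]

/-- The index `3j + t` of leg `(j, t)`. -/
def legIdx (e : Fin m × Fin 3) : ℕ := 3 * e.1.val + e.2.val

/-- Leg indices are `< 3m`. -/
theorem legIdx_lt (e : Fin m × Fin 3) : legIdx e < 3 * m := by
  unfold legIdx; have := e.1.isLt; have := e.2.isLt; omega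

/-- `legIdx` is injective. -/
theorem legIdx_injective : Function.Injective (legIdx (m := m)) := by
  rintro ⟨j, t⟩ ⟨j', t'⟩ h
  unfold legIdx at h
  simp only at h
  have hj : j.val = j'.val := by omega
  have ht : t.val = t'.val := by omega
  exact Prod.ext (Fin.ext hj) (Fin.ext ht)

/-- The pieced leg of leg `e` (block length `L`). -/
def plegOf (L : ℕ) (I : LocalMap 3 n m) (e : Fin m × Fin 3) : PLeg := pleg L (trips I) (legIdx e)

/-- The pieced leg of `e` is an item of `pieceLegs`. -/
theorem plegOf_mem (L : ℕ) (I : LocalMap 3 n m) (e : Fin m × Fin 3) : plegOf L I e ∈ pieceLegs L (trips I) := by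
  unfold plegOf pieceLegs
  refine List.mem_map.2 ⟨legIdx e, List.mem_range.2 ?_, rfl⟩
  rw [length_trips]; exact legIdx_lt e

/-- Every item of `pieceLegs` is the pieced leg of a unique leg. -/
theorem exists_eq_plegOf (L : ℕ) (I : LocalMap 3 n m) {x : PLeg} (hx : x ∈ pieceLegs L (trips I)) :
    ∃ e : Fin m × Fin 3, plegOf L I e = x := by
  unfold pieceLegs at hx
  obtain ⟨i, hi, rfl⟩ := List.mem_map.1 hx
  rw [List.mem_range, length_trips] at hi
  refine ⟨(⟨i / 3, by omega⟩, ⟨i % 3, by omega⟩), ?_⟩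
  unfold plegOf legIdx
  congr 1
  simp only
  omega

/-- `plegOf` is injective (the record carries `(j, t)`). -/
theorem plegOf_injective (L : ℕ) (I : LocalMap 3 n m) : Function.Injective (plegOf L I) := by
  intro e e' h
  apply legIdx_injective
  unfold plegOf pleg at h
  simp only [Prod.mk.injEq] at h
  omega

/-! ## The piece types and the structure maps -/

/-- LEFT PIECES: the left labels `(0, c, blk)` occurring among the pieced legs. -/
abbrev LPiece (L : ℕ) (I : LocalMap 3 n m) : Type := {P : Lab // P ∈ (pieceLegs L (trips I)).map labL}

/-- RIGHT PIECES: the right labels `(1, v, blk)` occurring among the pieced legs. -/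
abbrev RPiece (L : ℕ) (I : LocalMap 3 n m) : Type := {Q : Lab // Q ∈ (pieceLegs L (trips I)).map labR}

/-- The left piece of a leg. -/
def srcM (L : ℕ) (I : LocalMap 3 n m) (e : Fin m × Fin 3) : LPiece L I :=
  ⟨labL (plegOf L I e), List.mem_map.2 ⟨_, plegOf_mem L I e, rfl⟩⟩

/-- The right piece of a leg. -/
def dstM (L : ℕ) (I : LocalMap 3 n m) (e : Fin m × Fin 3) : RPiece L I :=
  ⟨labR (plegOf L I e), List.mem_map.2 ⟨_, plegOf_mem L I e, rfl⟩⟩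

/-- The vertex component of a left piece label is a head variable `< n`. -/
theorem lvertex_lt (L : ℕ) (I : LocalMap 3 n m) (P : LPiece L I) : P.1.2.1 < n := by
  obtain ⟨x, hx, hP⟩ := List.mem_map.1 P.2
  obtain ⟨⟨j, t⟩, rfl⟩ := exists_eq_plegOf L I hx
  rw [← hP]
  show lvert (trips I) (legIdx (j, t)) < n
  unfold legIdx
  rw [lvert_trips I j t.isLt]
  exact (I.vars j 0).isLt

/-- The vertex component of a right piece label is `0` (constant column) or a data variable `+ 1 ≤ n`. -/
theorem rvertex_le (L : ℕ) (I : LocalMap 3 n m) (Q : RPiece L I) : Q.1.2.1 ≤ n := by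
  obtain ⟨x, hx, hQ⟩ := List.mem_map.1 Q.2
  obtain ⟨⟨j, t⟩, rfl⟩ := exists_eq_plegOf L I hx
  rw [← hQ]
  show rvert (trips I) (legIdx (j, t)) ≤ n
  unfold legIdx
  have ht := t.isLt
  interval_cases h : t.val
  · rw [Nat.add_zero, rvert_trips_zero]; exact Nat.zero_le _
  · rw [rvert_trips_one]; exact (I.vars j 1).isLt
  · rw [rvert_trips_two]; exact (I.vars j 2).isLt

/-- The owner (head variable) of a left piece. -/
def own₁M (L : ℕ) (I : LocalMap 3 n m) (P : LPiece L I) : Fin n := ⟨P.1.2.1, lvertex_lt L I P⟩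

/-- The owner of a right piece: `none` = the constant column (vertex code `0`), `some v` for code `v + 1`. -/
def own₂M (L : ℕ) (I : LocalMap 3 n m) (Q : RPiece L I) : Option (Fin n) :=
  if h : Q.1.2.1 = 0 then none else some ⟨Q.1.2.1 - 1, by have := rvertex_le L I Q; omega⟩

/-- Compatibility (hsrc): the left piece of every leg of output `j` is owned by the head `c_j`. -/
theorem own₁M_srcM (L : ℕ) (I : LocalMap 3 n m) (j : Fin m) (t : Fin 3) :
    own₁M L I (srcM L I (j, t)) = I.vars j 0 := by
  apply Fin.ext
  show lvert (trips I) (legIdx (j, t)) = (I.vars j 0).val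
  unfold legIdx
  exact lvert_trips I j t.isLt

/-- Compatibility (hz): the head leg's right piece is the constant column. -/
theorem own₂M_dstM_zero (L : ℕ) (I : LocalMap 3 n m) (j : Fin m) : own₂M L I (dstM L I (j, 0)) = none := by
  unfold own₂M
  have h : (dstM L I (j, 0)).1.2.1 = 0 := by
    show rvert (trips I) (legIdx (j, (0 : Fin 3))) = 0
    unfold legIdx
    simp only [Fin.val_zero, Nat.add_zero]
    exact rvert_trips_zero I j
  rw [dif_pos h]

/-- Compatibility (ha): the first data leg's right piece is owned by `a_j`. -/
theorem own₂M_dstM_one (L : ℕ) (I : LocalMap 3 n m) (j : Fin m) :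
    own₂M L I (dstM L I (j, 1)) = some (I.vars j 1) := by
  unfold own₂M
  have h : (dstM L I (j, 1)).1.2.1 = (I.vars j 1).val + 1 := by
    show rvert (trips I) (legIdx (j, (1 : Fin 3))) = _
    unfold legIdx
    exact rvert_trips_one I j
  rw [dif_neg (by rw [h]; omega)]
  congr 1
  apply Fin.ext
  show (dstM L I (j, 1)).1.2.1 - 1 = (I.vars j 1).val
  rw [h]; omega

/-- Compatibility (hb): the second data leg's right piece is owned by `b_j`. -/
theorem own₂M_dstM_two (L : ℕ) (I : LocalMap 3 n m) (j : Fin m) :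
    own₂M L I (dstM L I (j, 2)) = some (I.vars j 2) := by
  unfold own₂M
  have h : (dstM L I (j, 2)).1.2.1 = (I.vars j 2).val + 1 := by
    show rvert (trips I) (legIdx (j, (2 : Fin 3))) = _
    unfold legIdx
    exact rvert_trips_two I j
  rw [dif_neg (by rw [h]; omega)]
  congr 1
  apply Fin.ext
  show (dstM L I (j, 2)).1.2.1 - 1 = (I.vars j 2).val
  rw [h]; omega

/-! ## Degree bounds -/

/-- The legs with a given left piece inject into the pieced legs with that left label. -/
theorem card_filter_srcM_le {L : ℕ} (hL : 0 < L) (I : LocalMap 3 n m) (P : LPiece L I) :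
    (Finset.univ.filter fun e => srcM L I e = P).card ≤ L := by
  classical
  have h1 : (Finset.univ.filter fun e => srcM L I e = P).card
      ≤ (((pieceLegs L (trips I)).filter fun x => labL x = P.1).toFinset).card := by
    refine Finset.card_le_card_of_injOn (plegOf L I) (fun e he => ?_) (fun a _ b _ h => plegOf_injective L I h)
    rw [Finset.mem_coe, Finset.mem_filter] at he
    rw [Finset.mem_coe, List.mem_toFinset, List.mem_filter]
    exact ⟨plegOf_mem L I e, by rw [decide_eq_true_eq]; exact congrArg Subtype.val he.2⟩
  refine h1.trans ((List.toFinset_card_le _).trans ?_)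
  have := length_nbrs_pieceLegs_le hL (trips I) P.1
  unfold nbrs at this
  rw [List.length_append, List.length_map, List.length_map] at this
  omega

/-- The legs with a given right piece inject into the pieced legs with that right label. -/
theorem card_filter_dstM_le {L : ℕ} (hL : 0 < L) (I : LocalMap 3 n m) (Q : RPiece L I) :
    (Finset.univ.filter fun e => dstM L I e = Q).card ≤ L := by
  classical
  have h1 : (Finset.univ.filter fun e => dstM L I e = Q).card
      ≤ (((pieceLegs L (trips I)).filter fun x => labR x = Q.1).toFinset).card := by
    refine Finset.card_le_card_of_injOn (plegOf L I) (fun e he => ?_) (fun a _ b _ h => plegOf_injective L I h)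
    rw [Finset.mem_coe, Finset.mem_filter] at he
    rw [Finset.mem_coe, List.mem_toFinset, List.mem_filter]
    exact ⟨plegOf_mem L I e, by rw [decide_eq_true_eq]; exact congrArg Subtype.val he.2⟩
  refine h1.trans ((List.toFinset_card_le _).trans ?_)
  have := length_nbrs_pieceLegs_le hL (trips I) Q.1
  unfold nbrs at this
  rw [List.length_append, List.length_map, List.length_map] at this
  omega

end Summit.PneNP.PneNP.Theorems.SfmBlMachine
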